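import Literature.AlgebraicGeometry.HodgeTheory.CotangentSheafComap
import Literature.AlgebraicGeometry.HodgeTheory.HodgeSheafWedge
import HarnessLib

/-!
# Pull-back of `j`-forms along a morphism of `S`-schemes: `g^♯ : Ωʲ_{X₁/S} → g_* Ωʲ_{X₀/S}`

Layer `Literature/AlgebraicGeometry/HodgeTheory`; companion of `CotangentSheafComap.lean` (the case
`j = 1`). For a commutative ring `S` and a morphism `g : X₀ ⟶ X₁` of `S`-schemes this file CONSTRUCTS
(real definitions, no named facts, no hypothesis structures) the pull-back of the Hodge sheaves
`Ωʲ_{X/S} = ⋀ʲ Ω¹_{X/S} = Motives.hodgeSheaf X j` (the sheaf associated to `U ↦ ⋀ʲ_{𝒪(U)} Γ(U, Ω¹)`,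
`HodgeTheory.formsPresheaf X j`, with sheafification map `toHodgeSheaf`):

* `formsPresheaf_induction` — induction on presheaf-level `j`-forms (pure wedges span, Mathlib
  `exteriorPower.ιMulti_span`);
* `resF`, `restrWedge` — the restriction maps of `𝒪` and of `⋀ʲ Γ(–, Ω¹)` in the native typing of
  the exterior powers (`restrWedge_apply`: definitionally `(formsPresheaf X j).map`), `restrWedge_mk`,
  `restrWedge_smul`;
* `appF g U` (`g♯` on functions), `comapOneApp g U` (the component of `g^♯` on `1`-forms,
  `CotangentSheafComap`), **`comapWedge g j U : ⋀ʲ Γ(U, Ω¹_{X₁}) →+ ⋀ʲ Γ(g⁻¹U, Ω¹_{X₀})`**,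
  `θ₁ ∧ ⋯ ∧ θⱼ ↦ g^♯θ₁ ∧ ⋯ ∧ g^♯θⱼ` (`Motives.exteriorPowerMap'`), semilinear over `g♯`
  (`comapWedge_smul`), natural in `U` (`restrWedge_comapWedge`);
* `comapFormsPresheafHom g j : ⋀ʲ Γ(–, Ω¹_{X₁}) ⟶ g_* Ωʲ_{X₀}` and, by the sheafification adjunction,
  **`hodgeSheaf.comap g j : Ωʲ_{X₁/S} ⟶ g_* Ωʲ_{X₀/S}`** with
  **`hodgeSheaf.comap_app_toHodgeSheaf : g^♯((θ₁ ∧ ⋯ ∧ θⱼ)^sh) = (g^♯θ₁ ∧ ⋯ ∧ g^♯θⱼ)^sh`**;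
* `hodgeSheaf.hom_ext_toHodgeSheaf` — maps out of `Ωʲ` are determined on presheaf-level forms;
* along an ISOMORPHISM `e : X₀ ≅ X₁`: the round trips `resF_backHom_appF_appF` (functions),
  `formsOne_map_backHom_comapOneApp_comapOneApp` (`1`-forms),
  `restrWedge_comapWedge_comapWedge` (`j`-forms), the key identity
  `hodgeSheaf.comap_comp_pushforward_comap_inv : e^♯ ≫ e_*((e⁻¹)^♯) ≫ (e_* e⁻¹_* Ωʲ ≅ Ωʲ) = 𝟙`,
  whence **`hodgeSheaf.isIso_comap_hom`** and **`hodgeSheaf.comapIso e j : Ωʲ_{X₁/S} ≅ e_* Ωʲ_{X₀/S}`**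
  with its inverse explicit (`comapIso_inv`).

Motivation (venture HSemireg, bridge (B1), residual gap (T)): with `Modules/PushforwardIsoCohomology`
(cohomology of `e_*`) and this file (the source `Ωʲ` of Bloch's pairing map), the transport of
`IsBlochSemiregular` along an isomorphism of the ambient scheme is reduced to the compatibility of
the pairing's TARGET `𝓐lt_r(𝓘; Ωⁿ|_Z)` with `e_*` and the naturality of the pairing.

References: R. Hartshorne, *Algebraic Geometry* (1977), II Ex. 5.16 (exterior powers of sheaves of
modules: the sheaf associated to the sectionwise exterior powers; (e) `f^*` commutes with `⋀`), II
Prop. 8.11 (the pull-back `f^*Ω_{Y/Z} → Ω_{X/Z}`), here in ADJOINT form (`g_*` instead of `g^*`) and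
typed weaker-or-equal (only the isomorphism case of the comparison is proved to be an isomorphism).
[Hartshorne1977]

Not here: the pull-back form `g^*Ωʲ_{X₁} → Ωʲ_{X₀}`; compatibility with the wedge `∧` and with `d`
beyond what the definitions give pointwise (`comapWedge_mk`, `CotangentSheafComap.comap_app_dSection`).
-/

noncomputable section

open CategoryTheory CategoryTheory.Limits AlgebraicGeometry Opposite TopologicalSpace

universe u

namespace Literature.AlgebraicGeometry.HodgeTheory

open Literature.AlgebraicGeometry.Modules Literature.AlgebraicGeometry.Motives

/-! ### Induction on presheaf-level forms -/

section FormsInduction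

variable {S : Type u} [CommRing S] {X : Over (Spec (CommRingCat.of S))} (j : ℕ)

/-- **Induction on presheaf-level `j`-forms**: a property of elements of `⋀ʲ Γ(U, Ω¹_{X/S})` that
holds on pure wedges `θ₁ ∧ ⋯ ∧ θⱼ` and is stable under `0`, `+` and the `Γ(X, U)`-action holds
everywhere (the pure wedges span the exterior power, Mathlib `exteriorPower.ιMulti_span`; reading of
the sectionwise exterior powers of Hartshorne II Ex. 5.16).
[cite: Hartshorne1977, II Ex. 5.16 (exterior powers of a sheaf of modules: the presheaf U ↦ ⋀ʲ F(U) and its associated sheaf)] -/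
theorem formsPresheaf_induction {U : X.left.Opens}
    {P : ((formsOne X).obj (op U)).exteriorPower j → Prop}
    (mk : ∀ m : Fin j → (formsOne X).obj (op U), P (ModuleCat.exteriorPower.mk m))
    (zero : P 0) (add : ∀ x y, P x → P y → P (x + y))
    (smul : ∀ (a : (X.left.presheaf ⋙ forget₂ CommRingCat RingCat).obj (op U)) (x), P x → P (a • x))
    (ω : ((formsOne X).obj (op U)).exteriorPower j) : P ω := by
  have hω : ω ∈ (⊤ : Submodule ((X.left.presheaf ⋙ forget₂ CommRingCat RingCat).obj (op U))
      (((formsOne X).obj (op U)).exteriorPower j)) := Submodule.mem_top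
  erw [← exteriorPower.ιMulti_span] at hω
  induction hω using Submodule.span_induction with
  | mem x hx =>
    obtain ⟨m, rfl⟩ := hx
    exact mk m
  | zero => exact zero
  | add x y _ _ hx hy => exact add x y hx hy
  | smul a x _ hx => exact smul a x hx

end FormsInduction

section RestrWedge

variable {S : Type u} [CommRing S] {X : Over (Spec (CommRingCat.of S))} (j : ℕ)

/-- The restriction of functions `Γ(X, U) → Γ(X, V)` as a ring map between the section rings in the
spelling `(𝒪_X ⋙ forget₂)(U)` over which the exterior powers `⋀ʲ Γ(U, Ω¹)` are modules
(definitional retyping of `X.presheaf.map i.op`). [folklore] -/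
def resF {U V : X.left.Opens} (i : V ⟶ U) :
    (X.left.presheaf ⋙ forget₂ CommRingCat RingCat).obj (op U) →+*
      (X.left.presheaf ⋙ forget₂ CommRingCat RingCat).obj (op V) :=
  (X.left.presheaf.map i.op).hom

/-- The restriction map `⋀ʲ Γ(U, Ω¹) → ⋀ʲ Γ(V, Ω¹)` of the presheaf `formsPresheaf X j`, as an
additive map between the exterior powers in their native typing (definitionally
`(formsPresheaf X j).map i.op`). [folklore] -/
def restrWedge {U V : X.left.Opens} (i : V ⟶ U) :
    ((formsOne X).obj (op U)).exteriorPower j →+ ((formsOne X).obj (op V)).exteriorPower j :=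
  (exteriorPowerMap' ((formsOne X).map i.op) j).hom.toAddMonoidHom

/-- `restrWedge` IS the restriction map of `formsPresheaf X j` (definitionally). [cite: Hartshorne1977, II Ex. 5.16 (exterior powers of a sheaf of modules: the presheaf U ↦ ⋀ʲ F(U) and its associated sheaf)] -/
theorem restrWedge_apply {U V : X.left.Opens} (i : V ⟶ U)
    (ω : ((formsOne X).obj (op U)).exteriorPower j) :
    restrWedge j i ω = (formsPresheaf X j).map i.op ω := rfl

/-- `restrWedge` on pure wedges: `(θ₁ ∧ ⋯ ∧ θⱼ)|_V = θ₁|_V ∧ ⋯ ∧ θⱼ|_V`. [cite: Hartshorne1977, II Ex. 5.16 (exterior powers of a sheaf of modules: the presheaf U ↦ ⋀ʲ F(U) and its associated sheaf)] -/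
theorem restrWedge_mk {U V : X.left.Opens} (i : V ⟶ U) (m : Fin j → (formsOne X).obj (op U)) :
    restrWedge j i (ModuleCat.exteriorPower.mk m) =
      ModuleCat.exteriorPower.mk (M := (formsOne X).obj (op V))
        (fun k => ((formsOne X).map i.op (m k) : (formsOne X).obj (op V))) :=
  exteriorPowerMap'_mk _ m

/-- `restrWedge` is semilinear over the restriction of functions. [cite: Hartshorne1977, II Ex. 5.16 (exterior powers of a sheaf of modules: the presheaf U ↦ ⋀ʲ F(U) and its associated sheaf)] -/
theorem restrWedge_smul {U V : X.left.Opens} (i : V ⟶ U)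
    (a : (X.left.presheaf ⋙ forget₂ CommRingCat RingCat).obj (op U))
    (ω : ((formsOne X).obj (op U)).exteriorPower j) :
    restrWedge j i (a • ω) = resF i a • restrWedge j i ω :=
  (exteriorPowerMap' ((formsOne X).map i.op) j).hom.map_smul a ω

end RestrWedge

section HodgeComap

variable {S : Type u} [CommRing S] {X₀ X₁ : Over (Spec (CommRingCat.of S))} (g : X₀ ⟶ X₁) (j : ℕ)

/-- The `𝒪_{X₁}`-module `g_* Ωʲ_{X₀/S}`. [folklore] -/
abbrev pushforwardHodgeSheaf : X₁.left.Modules :=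
  (Scheme.Modules.pushforward g.left).obj (hodgeSheaf X₀ j)

/-- `g♯ : Γ(X₁, U) → Γ(X₀, g⁻¹U)` as a ring map in the `forget₂` spelling of the section rings
(definitional retyping of `g.left.app U`). [folklore] -/
def appF (U : X₁.left.Opens) :
    (X₁.left.presheaf ⋙ forget₂ CommRingCat RingCat).obj (op U) →+*
      (X₀.left.presheaf ⋙ forget₂ CommRingCat RingCat).obj (op (g.left ⁻¹ᵁ U)) :=
  (g.left.app U).hom

/-- `g♯` commutes with restriction: `g♯(a|_V) = (g♯ a)|_{g⁻¹V}`. [folklore] -/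
private theorem appF_resF {U V : X₁.left.Opens} (i : V ⟶ U)
    (a : (X₁.left.presheaf ⋙ forget₂ CommRingCat RingCat).obj (op U)) :
    appF g V (resF i a) = resF ((Opens.map g.left.base).map i) (appF g U a) :=
  ConcreteCategory.congr_hom (g.left.naturality i.op) a

/-- The component of `g^♯ : Ω¹_{X₁/S} ⟶ g_* Ω¹_{X₀/S}` at `U`, as a SEMILINEAR map
`Γ(U, Ω¹_{X₁}) → Γ(g⁻¹U, Ω¹_{X₀})` over `g♯ : Γ(X₁, U) → Γ(X₀, g⁻¹U)` (definitional retyping, the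
shape `Motives.exteriorPowerMap'` consumes). [folklore] -/
abbrev comapOneApp (U : X₁.left.Opens) :
    (formsOne X₁).obj (op U) ⟶
      (ModuleCat.restrictScalars (appF g U)).obj ((formsOne X₀).obj (op (g.left ⁻¹ᵁ U))) :=
  (cotangentSheaf.comap g).val.app (op U)

/-- Naturality of the components `comapOneApp` (that of `g^♯`). [folklore] -/
private theorem map_comapOneApp {U V : X₁.left.Opens} (i : V ⟶ U) (θ : (formsOne X₁).obj (op U)) :
    ((formsOne X₀).map ((Opens.map g.left.base).map i).op (comapOneApp g U θ) :
        (formsOne X₀).obj (op (g.left ⁻¹ᵁ V))) =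
      comapOneApp g V ((formsOne X₁).map i.op θ) :=
  (PresheafOfModules.naturality_apply (cotangentSheaf.comap g).val i.op θ).symm

/-- The pull-back of a presheaf-level `j`-form before sheafification:
`⋀ʲ Γ(U, Ω¹_{X₁}) → ⋀ʲ Γ(g⁻¹U, Ω¹_{X₀})`, `θ₁ ∧ ⋯ ∧ θⱼ ↦ g^♯θ₁ ∧ ⋯ ∧ g^♯θⱼ`
(`Motives.exteriorPowerMap'` of `comapOneApp`, as an additive map in native typing). [folklore] -/
def comapWedge (U : X₁.left.Opens) :
    ((formsOne X₁).obj (op U)).exteriorPower j →+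
      ((formsOne X₀).obj (op (g.left ⁻¹ᵁ U))).exteriorPower j :=
  (exteriorPowerMap' (comapOneApp g U) j).hom.toAddMonoidHom

/-- `comapWedge` is semilinear over `g♯`: `⋀ʲg^♯(a ω) = g♯(a) ⋀ʲg^♯(ω)`. [cite: Hartshorne1977, II Ex. 5.16 (e) with II Prop. 8.11 (pull-back of exterior powers of differentials, adjoint form)] -/
theorem comapWedge_smul (U : X₁.left.Opens)
    (a : (X₁.left.presheaf ⋙ forget₂ CommRingCat RingCat).obj (op U))
    (ω : ((formsOne X₁).obj (op U)).exteriorPower j) :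
    comapWedge g j U (a • ω) = appF g U a • comapWedge g j U ω :=
  (exteriorPowerMap' (comapOneApp g U) j).hom.map_smul a ω

/-- `comapWedge` on pure wedges: `θ₁ ∧ ⋯ ∧ θⱼ ↦ g^♯θ₁ ∧ ⋯ ∧ g^♯θⱼ`. [cite: Hartshorne1977, II Ex. 5.16 (e) with II Prop. 8.11 (pull-back of exterior powers of differentials, adjoint form)] -/
theorem comapWedge_mk (U : X₁.left.Opens) (m : Fin j → (formsOne X₁).obj (op U)) :
    comapWedge g j U (ModuleCat.exteriorPower.mk m) =
      ModuleCat.exteriorPower.mk (M := (formsOne X₀).obj (op (g.left ⁻¹ᵁ U)))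
        (fun k => (comapOneApp g U (m k) : (formsOne X₀).obj (op (g.left ⁻¹ᵁ U)))) :=
  exteriorPowerMap'_mk (comapOneApp g U) m

/-- **Naturality of `comapWedge` in `U`**: restricting then pulling back = pulling back then
restricting, on presheaf-level `j`-forms. [cite: Hartshorne1977, II Ex. 5.16 (e) with II Prop. 8.11 (pull-back of exterior powers of differentials, adjoint form)] -/
theorem restrWedge_comapWedge {U V : X₁.left.Opens} (i : V ⟶ U)
    (ω : ((formsOne X₁).obj (op U)).exteriorPower j) :
    restrWedge j ((Opens.map g.left.base).map i) (comapWedge g j U ω) =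
      comapWedge g j V (restrWedge j i ω) := by
  induction ω using formsPresheaf_induction j with
  | mk m =>
    rw [comapWedge_mk, restrWedge_mk, restrWedge_mk, comapWedge_mk]
    congr 1
    funext k
    exact map_comapOneApp g i (m k)
  | zero => simp only [map_zero]
  | add x y hx hy => simp only [map_add, hx, hy]
  | smul a x hx =>
    rw [comapWedge_smul, restrWedge_smul, hx, restrWedge_smul, comapWedge_smul, appF_resF]

/-- The pull-back of presheaf-level `j`-forms followed by sheafification on `X₀`, as a morphism of
presheaves of modules `⋀ʲ Γ(–, Ω¹_{X₁}) ⟶ g_* Ωʲ_{X₀}` over `𝒪_{X₁}`: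
`θ₁ ∧ ⋯ ∧ θⱼ ↦ (g^♯θ₁ ∧ ⋯ ∧ g^♯θⱼ)^sh`. [folklore] -/
def comapFormsPresheafHom :
    formsPresheaf X₁ j ⟶ (PresheafOfModules.restrictScalars (𝟙 X₁.left.ringCatSheaf.obj)).obj
      (pushforwardHodgeSheaf g j).val :=
  PresheafOfModules.homMk
    { app := fun U => AddCommGrpCat.ofHom
        { toFun := fun ω => ((toHodgeSheaf X₀ j).app (op (g.left ⁻¹ᵁ U.unop)) (comapWedge g j U.unop ω) :
            Γ(hodgeSheaf X₀ j, g.left ⁻¹ᵁ U.unop))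
          map_zero' := by
            have h1 : comapWedge g j U.unop 0 = 0 := map_zero _
            have h2 : (toHodgeSheaf X₀ j).app (op (g.left ⁻¹ᵁ U.unop))
                (0 : ((formsOne X₀).obj (op (g.left ⁻¹ᵁ U.unop))).exteriorPower j) = 0 := map_zero _
            exact (congrArg (fun x => (toHodgeSheaf X₀ j).app (op (g.left ⁻¹ᵁ U.unop)) x) h1).trans h2
          map_add' := fun ω ω' => by
            have h1 : comapWedge g j U.unop (ω + ω') = comapWedge g j U.unop ω + comapWedge g j U.unop ω' :=
              map_add _ _ _
            exact (congrArg (fun x => (toHodgeSheaf X₀ j).app (op (g.left ⁻¹ᵁ U.unop)) x) h1).trans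
              (map_add _ _ _) }
      naturality := fun {U V} i => by
        refine AddCommGrpCat.ext fun (ω : ((formsOne X₁).obj U).exteriorPower j) => ?_
        change (toHodgeSheaf X₀ j).app (op (g.left ⁻¹ᵁ V.unop))
            (comapWedge g j V.unop (restrWedge j i.unop ω)) =
          (hodgeSheaf X₀ j).val.map ((Opens.map g.left.base).map i.unop).op
            ((toHodgeSheaf X₀ j).app (op (g.left ⁻¹ᵁ U.unop)) (comapWedge g j U.unop ω))
        rw [← restrWedge_comapWedge]
        exact PresheafOfModules.naturality_apply (toHodgeSheaf X₀ j)
          ((Opens.map g.left.base).map i.unop).op (comapWedge g j U.unop ω) }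
    (fun U (a : (X₁.left.presheaf ⋙ forget₂ CommRingCat RingCat).obj U)
        (ω : ((formsOne X₁).obj U).exteriorPower j) => by
      change (toHodgeSheaf X₀ j).app (op (g.left ⁻¹ᵁ U.unop)) (comapWedge g j U.unop (a • ω)) =
        (g.left.app U.unop a • (toHodgeSheaf X₀ j).app (op (g.left ⁻¹ᵁ U.unop))
          (comapWedge g j U.unop ω) : Γ(hodgeSheaf X₀ j, g.left ⁻¹ᵁ U.unop))
      rw [comapWedge_smul]
      exact ((toHodgeSheaf X₀ j).app (op (g.left ⁻¹ᵁ U.unop))).hom.map_smul _ _)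

/-- Components of `comapFormsPresheafHom`. [folklore] -/
private theorem comapFormsPresheafHom_app_apply (U : X₁.left.Opens)
    (ω : ((formsOne X₁).obj (op U)).exteriorPower j) :
    (comapFormsPresheafHom g j).app (op U) ω =
      (toHodgeSheaf X₀ j).app (op (g.left ⁻¹ᵁ U)) (comapWedge g j U ω) := rfl

/-- **Pull-back of `j`-forms along a morphism of `S`-schemes**: the morphism of `𝒪_{X₁}`-modules
`g^♯ : Ωʲ_{X₁/S} ⟶ g_* Ωʲ_{X₀/S}` (the `j`-th exterior power of the pull-back of `1`-forms,
sheafified: Hartshorne II Ex. 5.16 (e) `f^*(⋀ F) = ⋀(f^* F)` composed with II 8.11, in adjoint form),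
obtained from `comapFormsPresheafHom` by the sheafification adjunction.
[cite: Hartshorne1977, II Ex. 5.16 (e) with II Prop. 8.11 (pull-back of exterior powers of differentials, adjoint form)] -/
def hodgeSheaf.comap : hodgeSheaf X₁ j ⟶ pushforwardHodgeSheaf g j :=
  ((PresheafOfModules.sheafificationAdjunction (𝟙 X₁.left.ringCatSheaf.obj)).homEquiv _ _).symm
    (comapFormsPresheafHom g j)

/-- The defining triangle: after the sheafification map `toHodgeSheaf`, `hodgeSheaf.comap g j` is
`comapFormsPresheafHom g j`. [folklore] -/
private theorem toHodgeSheaf_comp_comap :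
    toHodgeSheaf X₁ j ≫ (PresheafOfModules.restrictScalars (𝟙 X₁.left.ringCatSheaf.obj)).map
      (hodgeSheaf.comap g j).val = comapFormsPresheafHom g j := by
  change (PresheafOfModules.sheafificationAdjunction (𝟙 X₁.left.ringCatSheaf.obj)).homEquiv
    (formsPresheaf X₁ j) (pushforwardHodgeSheaf g j) (hodgeSheaf.comap g j) = comapFormsPresheafHom g j
  exact Equiv.apply_symm_apply _ _

/-- **`g^♯` on (images of) presheaf-level forms**: `g^♯((θ₁ ∧ ⋯ ∧ θⱼ)^sh) = (g^♯θ₁ ∧ ⋯ ∧ g^♯θⱼ)^sh`,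
i.e. `(hodgeSheaf.comap g j)(toHodgeSheaf ω) = toHodgeSheaf (comapWedge ω)` in
`Γ(g_* Ωʲ_{X₀}, U) = Γ(Ωʲ_{X₀}, g⁻¹U)`.
[cite: Hartshorne1977, II Ex. 5.16 (e) with II Prop. 8.11 (pull-back of exterior powers of differentials, adjoint form)] -/
theorem hodgeSheaf.comap_app_toHodgeSheaf (U : X₁.left.Opens)
    (ω : ((formsOne X₁).obj (op U)).exteriorPower j) :
    (hodgeSheaf.comap g j).app U ((toHodgeSheaf X₁ j).app (op U) ω) =
      (toHodgeSheaf X₀ j).app (op (g.left ⁻¹ᵁ U)) (comapWedge g j U ω) := by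
  rw [← comapFormsPresheafHom_app_apply]
  exact congrArg (fun f => (PresheafOfModules.Hom.app f (op U)).hom ω) (toHodgeSheaf_comp_comap g j)

end HodgeComap

/-! ### Morphisms out of `Ωʲ_{X/S}` are determined on presheaf-level forms -/

section HodgeExt

variable {S : Type u} [CommRing S] {X : Over (Spec (CommRingCat.of S))} (j : ℕ) {N : X.left.Modules}

/-- **Two `𝒪_X`-linear maps out of `Ωʲ_{X/S}` that agree on (the images of) all presheaf-level
`j`-forms `ω ∈ ⋀ʲ Γ(U, Ω¹)` are equal** (`Ωʲ` is the sheaf associated to `U ↦ ⋀ʲ Γ(U, Ω¹)`;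
sheafification adjunction). [cite: Hartshorne1977, II Ex. 5.16 (the exterior power of a sheaf of modules is the sheaf associated to the sectionwise exterior powers)] -/
theorem hodgeSheaf.hom_ext_toHodgeSheaf (φ₁ φ₂ : hodgeSheaf X j ⟶ N)
    (h : ∀ (U : X.left.Opens) (ω : ((formsOne X).obj (op U)).exteriorPower j),
      φ₁.app U ((toHodgeSheaf X j).app (op U) ω) = φ₂.app U ((toHodgeSheaf X j).app (op U) ω)) :
    φ₁ = φ₂ := by
  apply ((PresheafOfModules.sheafificationAdjunction (𝟙 X.left.ringCatSheaf.obj)).homEquiv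
    (formsPresheaf X j) N).injective
  rw [Adjunction.homEquiv_unit, Adjunction.homEquiv_unit]
  refine PresheafOfModules.hom_ext fun U => ?_
  ext ω
  exact h U.unop ω

end HodgeExt


end Literature.AlgebraicGeometry.HodgeTheory

end
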